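import Summits.KontsevichZagierPeriods.KontsevichZagierPeriods.Theses.SelbergAMGM
import Summits.KontsevichZagierPeriods.KontsevichZagierPeriods.Theorems.InverseLandauTateLiftingPullback
import Literature.NumberTheory.Transcendental.KZProductIdeal
import Literature.NumberTheory.Transcendental.KZDominatedFamilyRelations
import Literature.NumberTheory.Transcendental.SemialgebraicRpow

/-!
# `SelbergDuplicationHalf` (stmt-KontsevichZagierPeriods-5622, route SelbergAMGM) — proof

For rational `a, b` and ANY two Kontsevich–Zagier representations on `ℝ²`,
`r = [(0,1)², (x₀x₁)^{a−1}((1−x₀)(1−x₁))^{b−1}|x₀ − x₁|]` (the `n = 2`, `γ = ½` Selberg integral,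
`= 8B(2a,2b)/(2a+2b)`) and `r' = [(0,1)², 8x₀^{2a−1}(1−x₀)^{2b−1}x₁^{2a+2b−1}]`, pinned by their domains
and by their integrands ON the domains, `KZ.Equivalent r r'` holds INSIDE the rules (Kontsevich–Zagier
2001, §1.2) — the "AM–GM collapse" at `n = 2`: symmetrisation `[r] − 2[W]`, `W = [{x₀ < x₁}, f]`
(rules (1), (1a), (2): null diagonal, two ordered halves, swap); the Vieta chart
`(x₀,x₁) ↦ (s,p) = (x₀+x₁, x₀x₁)` whose Jacobian `|x₀ − x₁|` IS the Vandermonde factor (rule (2)),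
onto `E = {p > 0, 1−s+p > 0, 4p < s², 0 < s < 2}` with `[W] − [E, p^{a−1}(1−s+p)^{b−1}]`; the AM–GM
chart `Ψ(w,t) = (1 + t²(2w−1), (wt)²)` of `E` by the square (rule (2), `tateLifting_pullback`):
`p = (wt)²`, `1−s+p = ((1−w)t)²` (the two geometric means, `t < 1` their sum), `|det DΨ| = 4w(1−w)t³`,
`s² − 4p = (1−t²)(1−t²(2w−1)²)`, pull-back `[(0,1)², 4w^{2a−1}(1−w)^{2b−1}t^{2a+2b−1}]`; rule (1b)
collects the factor `2`. No definition is introduced; `a, b > 0` is not used.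
References: Kontsevich–Zagier 2001, §1.2; A. Selberg, Norsk Mat. Tidsskr. 26 (1944); G. W. Anderson,
Forum Math. 3 (1991); Andrews–Askey–Roy 1999, §8.1.
-/

noncomputable section

open MeasureTheory Set
open Literature.NumberTheory.Transcendental Literature.NumberTheory.Transcendental.KZ
open Literature.ModelTheory.ExponentialFields (IsSemialgebraic)
open MvPolynomial (X)

namespace Summit.KontsevichZagierPeriods.SelbergAMGM

namespace DuplicationHalf

/-- The ordered half `T = {0 < x₀ < x₁ < 1}` of the unit square and the Vieta region
`E = {(s,p) | p > 0, 1 − s + p > 0, 4p < s², 0 < s < 2}` are `ℚ`-semialgebraic (finitely many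
strict `ℚ`-polynomial inequalities). [folklore] -/
theorem isSemialgebraic_halfBox_vieta :
    IsSemialgebraic ℚ {x : Fin 2 → ℝ | 0 < x 0 ∧ x 0 < x 1 ∧ x 1 < 1} ∧
    IsSemialgebraic ℚ {y : Fin 2 → ℝ | 0 < y 1 ∧ 0 < 1 - y 0 + y 1 ∧ 4 * y 1 < y 0 ^ 2 ∧
      0 < y 0 ∧ y 0 < 2} := by
  constructor
  · convert isSemialgebraic_setOf_forall_aeval_pos
      ![(X 0 : MvPolynomial (Fin 2) ℚ), X 1 - X 0, 1 - X 1] using 2 with x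
    simp [Fin.forall_fin_succ, sub_pos]
  · convert isSemialgebraic_setOf_forall_aeval_pos
      ![(X 1 : MvPolynomial (Fin 2) ℚ), 1 - X 0 + X 1, X 0 ^ 2 - 4 * X 1, X 0, 2 - X 0] using 2 with y
    simp [Fin.forall_fin_succ, sub_pos]

/-- **Symmetrisation.** For `f` invariant under the coordinate swap and `r = [(0,1)², ·]` with
integrand `f` on the square, the ordered half `W = [{0 < x₀ < x₁ < 1}, f]` exists and
`[r] − 2[W] ∈ KZ.relations`: restrict `r` off the null diagonal (rule (1)), split into the two ordered
halves (rule (1a)), carry `[W]` to the other half by the swap (rule (2)). [cite: KontsevichZagier2001, §1.2 rules (1), (2)] -/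
theorem symmetrise (f : (Fin 2 → ℝ) → ℝ)
    (hf : ∀ x : Fin 2 → ℝ, f (fun i => x (Equiv.swap (0 : Fin 2) 1 i)) = f x) (r : IntegralRep 2)
    (hrd : r.domain = {x | ∀ i, x i ∈ Set.Ioo (0:ℝ) 1}) (hri : EqOn r.integrand f r.domain) :
    ∃ W : IntegralRep 2, W.domain = {x | 0 < x 0 ∧ x 0 < x 1 ∧ x 1 < 1} ∧ W.integrand = f ∧
      of r - 2 • of W ∈ relations := by
  -- adapted from `wdt_wedge_symmetrise` (Theorems/HurwitzMicroSectorsNormalFormPrincipleM3WdtWedgeSymmetrise.lean)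
  have hT := isSemialgebraic_halfBox_vieta.1
  have hsubl : {x : Fin 2 → ℝ | 0 < x 0 ∧ x 0 < x 1 ∧ x 1 < 1} ⊆ r.domain := by
    rw [hrd]
    exact fun x hx => Fin.forall_fin_two.2 ⟨⟨hx.1, hx.2.1.trans hx.2.2⟩, ⟨hx.1.trans hx.2.1, hx.2.2⟩⟩
  let W : IntegralRep 2 := ⟨{x | 0 < x 0 ∧ x 0 < x 1 ∧ x 1 < 1}, f, hT,
    (r.isSemialgebraicFunOn_integrand.mono hsubl hT).congr (hri.mono hsubl),
    (r.integrableOn.mono_set hsubl).congr_fun (hri.mono hsubl) hT.measurableSet_holds⟩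
  have hWd : W.domain = {x | 0 < x 0 ∧ x 0 < x 1 ∧ x 1 < 1} := rfl
  refine ⟨W, rfl, rfl, ?_⟩
  -- the swapped half `Ws = W ∘ swap` and the permutation move `[W] − [Ws]` (rule (2))
  have hsd : (W.reindex (Equiv.swap (0 : Fin 2) 1)).domain = {x | 0 < x 1 ∧ x 1 < x 0 ∧ x 0 < 1} := by
    ext w
    simp only [IntegralRep.reindex_domain, hWd, mem_setOf_eq, Equiv.swap_apply_left,
      Equiv.swap_apply_right]
  have hsi : ∀ w, (W.reindex (Equiv.swap (0 : Fin 2) 1)).integrand w = f w := fun w => hf w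
  have e2 : of W - of (W.reindex (Equiv.swap (0 : Fin 2) 1)) ∈ relations :=
    of_sub_of_reindex_mem_relations W (Equiv.swap (0 : Fin 2) 1)
  generalize W.reindex (Equiv.swap (0 : Fin 2) 1) = Ws at hsd hsi e2
  have hsubg : Ws.domain ⊆ r.domain := by
    rw [hsd, hrd]
    exact fun x hx => Fin.forall_fin_two.2 ⟨⟨hx.1.trans hx.2.1, hx.2.2⟩, ⟨hx.1, hx.2.1.trans hx.2.2⟩⟩
  have hE : IsSemialgebraic ℚ (W.domain ∪ Ws.domain) :=
    W.isSemialgebraic_domain.union Ws.isSemialgebraic_domain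
  have hEr : W.domain ∪ Ws.domain ⊆ r.domain := union_subset hsubl hsubg
  -- the diagonal `{x₀ = x₁}` is null (zero set of the nonzero `ℚ`-polynomial `X₀ − X₁`)
  have hdiag : volume {x : Fin 2 → ℝ | x 0 = x 1} = 0 := by
    have hq : MvPolynomial.map (algebraMap ℚ ℝ) (X 0 - X 1 : MvPolynomial (Fin 2) ℚ) ≠ 0 := by
      rw [map_sub, MvPolynomial.map_X, MvPolynomial.map_X]
      exact sub_ne_zero.mpr (MvPolynomial.X_injective.ne (by decide))
    simpa [sub_eq_zero] using volume_setOf_aeval_eq_zero (X 0 - X 1 : MvPolynomial (Fin 2) ℚ) hq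
  have hvol : volume (r.domain \ (W.domain ∪ Ws.domain)) = 0 := by
    refine measure_mono_null (fun x hx => ?_) hdiag
    rw [hrd, hWd, hsd] at hx
    simp only [mem_sdiff, mem_union, mem_setOf_eq] at hx
    obtain ⟨hb, hn⟩ := hx
    show x 0 = x 1
    by_contra hne
    rcases lt_or_gt_of_ne hne with h | h
    · exact hn (Or.inl ⟨(hb 0).1, h, (hb 1).2⟩)
    · exact hn (Or.inr ⟨(hb 1).1, h, (hb 0).2⟩)
  have hint : volume (W.domain ∩ Ws.domain) = 0 := by
    refine measure_mono_null (fun x hx => ?_) hdiag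
    rw [hWd, hsd] at hx
    exact absurd (hx.1.2.1.trans hx.2.2.1) (lt_irrefl _)
  -- rule (1): `[r] − [r|H]`, `H = T ∪ T'` co-null; rule (1a): `[r|H] − [W] − [Ws]`
  have e0 : of r - of (r.restrict _ hE hEr) ∈ relations :=
    r.of_sub_of_restrict_mem_relations hE hEr hvol
  have e1 : of (r.restrict _ hE hEr) - of W - of Ws ∈ relations :=
    domainAddRel_subset_relations ⟨2, r.restrict _ hE hEr, W, Ws, rfl, hint,
      fun x hx => hri (hsubl hx), fun x hx => (hri (hsubg hx)).trans (hsi x).symm, rfl⟩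
  rw [show of r - 2 • of W = (of r - of (r.restrict _ hE hEr)) +
      (of (r.restrict _ hE hEr) - of W - of Ws) - (of W - of Ws) by rw [two_smul]; abel]
  exact relations.sub_mem (relations.add_mem e0 e1) e2

/-- **The Vieta move.** For `W = [{0 < x₀ < x₁ < 1}, f]`, `f` the Selberg integrand, the honest
representation `V = [E, p^{a−1}(1 − s + p)^{b−1}]` on the Vieta region EXISTS (`E` semialgebraic, the
integrand a product of rational powers of positive polynomials, integrable on `E = Φ(T)` by the Jacobian
criterion since its pull-back is `f`) and `[W] − [V] ∈ KZ.relations`: ONE change of variables (rule (2))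
along the Vieta chart `Φ(x₀,x₁) = (x₀+x₁, x₀x₁)` (`det DΦ = x₀ − x₁`, the Vandermonde factor; injective
on the ordered half, onto `E`: inverse = the roots `(s ∓ √(s² − 4p))/2`). [cite: KontsevichZagier2001, §1.2 rule (2)] -/
theorem vieta_move (a b : ℚ) (W : IntegralRep 2)
    (hWd : W.domain = {x | 0 < x 0 ∧ x 0 < x 1 ∧ x 1 < 1})
    (hWi : W.integrand = fun x => (x 0 * x 1) ^ ((a : ℝ) - 1) *
      ((1 - x 0) * (1 - x 1)) ^ ((b : ℝ) - 1) * |x 0 - x 1|) :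
    ∃ V : IntegralRep 2,
      V.domain = {y | 0 < y 1 ∧ 0 < 1 - y 0 + y 1 ∧ 4 * y 1 < y 0 ^ 2 ∧ 0 < y 0 ∧ y 0 < 2} ∧
      (V.integrand = fun y => (y 1) ^ ((a : ℝ) - 1) * (1 - y 0 + y 1) ^ ((b : ℝ) - 1)) ∧
      of W - of V ∈ relations := by
  obtain ⟨hT, hE⟩ := isSemialgebraic_halfBox_vieta
  set T : Set (Fin 2 → ℝ) := {x | 0 < x 0 ∧ x 0 < x 1 ∧ x 1 < 1}
  set E : Set (Fin 2 → ℝ) := {y | 0 < y 1 ∧ 0 < 1 - y 0 + y 1 ∧ 4 * y 1 < y 0 ^ 2 ∧ 0 < y 0 ∧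
    y 0 < 2}
  set Φ : (Fin 2 → ℝ) → (Fin 2 → ℝ) := fun x => ![x 0 + x 1, x 0 * x 1] with hΦ
  -- derivative and Jacobian `det DΦ = x₀ − x₁`
  have hD : ∀ x : Fin 2 → ℝ, ∃ L : (Fin 2 → ℝ) →L[ℝ] (Fin 2 → ℝ),
      HasFDerivAt Φ L x ∧ L.det = x 0 - x 1 := by
    intro x
    have h0 : HasFDerivAt (fun y : Fin 2 → ℝ => y 0)
      (ContinuousLinearMap.proj (R := ℝ) (φ := fun _ : Fin 2 => ℝ) 0) x := hasFDerivAt_apply 0 x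
    have h1 : HasFDerivAt (fun y : Fin 2 → ℝ => y 1)
      (ContinuousLinearMap.proj (R := ℝ) (φ := fun _ : Fin 2 => ℝ) 1) x := hasFDerivAt_apply 1 x
    refine ⟨_, (h0.add h1).finCons ((h0.mul h1).finCons (hasFDerivAt_const ![] x)), ?_⟩
    rw [ContinuousLinearMap.det, ← LinearMap.det_toMatrix', Matrix.det_fin_two]
    simp [LinearMap.toMatrix'_apply]
  choose Φ' hderiv hdet using hD
  -- injective on the ordered half: `(x₀ − y₀)(x₀ − y₁) = 0` by Vieta, and the order decides
  have hinj : InjOn Φ T := by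
    intro x hx y hy hxy
    have e0 : x 0 + x 1 = y 0 + y 1 := congrFun hxy 0
    have e1 : x 0 * x 1 = y 0 * y 1 := congrFun hxy 1
    have hq : (x 0 - y 0) * (x 0 - y 1) = 0 := by linear_combination (x 0) * e0 - e1
    rcases mul_eq_zero.1 hq with h | h
    · have h0 : x 0 = y 0 := sub_eq_zero.1 h
      exact funext (Fin.forall_fin_two.2 ⟨h0, by linarith⟩)
    · have h0 : x 0 = y 1 := sub_eq_zero.1 h
      exfalso
      linarith [hx.2.1, hy.2.1]
  have himage : Φ '' T = E := by
    ext y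
    constructor
    · rintro ⟨x, ⟨h0, h01, h1⟩, rfl⟩
      have h1' : 0 < x 1 := h0.trans h01
      have hx0 : x 0 < 1 := h01.trans h1
      refine ⟨mul_pos h0 h1', ?_, ?_, ?_, ?_⟩
      · show 0 < 1 - (x 0 + x 1) + x 0 * x 1; nlinarith [mul_pos (sub_pos.2 hx0) (sub_pos.2 h1)]
      · show 4 * (x 0 * x 1) < (x 0 + x 1) ^ 2; nlinarith [pow_pos (sub_pos.2 h01) 2]
      · show 0 < x 0 + x 1; linarith
      · show x 0 + x 1 < 2; linarith
    · rintro ⟨hy1, hy2, hy3, hy0, hy02⟩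
      have hD : 0 < y 0 ^ 2 - 4 * y 1 := by linarith
      set d := Real.sqrt (y 0 ^ 2 - 4 * y 1) with hd
      have hdpos : 0 < d := Real.sqrt_pos.2 hD
      have hd2 : d ^ 2 = y 0 ^ 2 - 4 * y 1 := Real.sq_sqrt hD.le
      have hdy : d < y 0 := by rw [hd, Real.sqrt_lt' hy0]; linarith
      have hd2y : d < 2 - y 0 := by rw [hd, Real.sqrt_lt' (by linarith)]; nlinarith
      refine ⟨![(y 0 - d) / 2, (y 0 + d) / 2], ⟨?_, ?_, ?_⟩, funext (Fin.forall_fin_two.2 ⟨?_, ?_⟩)⟩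
      · show 0 < (y 0 - d) / 2; linarith
      · show (y 0 - d) / 2 < (y 0 + d) / 2; linarith
      · show (y 0 + d) / 2 < 1; linarith
      · show (y 0 - d) / 2 + (y 0 + d) / 2 = y 0; ring
      · show (y 0 - d) / 2 * ((y 0 + d) / 2) = y 1; linear_combination (-1 / 4 : ℝ) * hd2
  -- the pointwise Jacobian identity `f = (h ∘ Φ)·|det DΦ|` (`(1−x₀)(1−x₁) = 1 − s + p`)
  have hpt : ∀ x : Fin 2 → ℝ, (x 0 * x 1) ^ ((a : ℝ) - 1) *
      ((1 - x 0) * (1 - x 1)) ^ ((b : ℝ) - 1) * |x 0 - x 1| =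
      (Φ x 1) ^ ((a : ℝ) - 1) * (1 - Φ x 0 + Φ x 1) ^ ((b : ℝ) - 1) * |(Φ' x).det| := by
    intro x
    rw [hdet, show Φ x 0 = x 0 + x 1 from rfl, show Φ x 1 = x 0 * x 1 from rfl,
      show 1 - (x 0 + x 1) + x 0 * x 1 = (1 - x 0) * (1 - x 1) by ring]
  have hh : IsSemialgebraicFunOn ℚ E
      (fun y => (y 1) ^ ((a : ℝ) - 1) * (1 - y 0 + y 1) ^ ((b : ℝ) - 1)) := by
    have h1 := IsSemialgebraicFunOn.rpow_ratCast hE (isSemialgebraicFunOn_apply hE 1)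
      (fun y hy => hy.1) (a - 1)
    have hlin : IsSemialgebraicFunOn ℚ E (fun y : Fin 2 → ℝ => 1 - y 0 + y 1) :=
      (isSemialgebraicFunOn_aeval hE (1 - X 0 + X 1 : MvPolynomial (Fin 2) ℚ)).congr
        fun y _ => by simp
    have h2 := IsSemialgebraicFunOn.rpow_ratCast hE hlin (fun y hy => hy.2.1) (b - 1)
    refine (IsSemialgebraicFunOn.mul_holds h1 h2).congr fun y _ => ?_
    simp only [Pi.mul_apply, Rat.cast_sub, Rat.cast_one]
  have hTm : MeasurableSet T := hT.measurableSet_holds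
  have hint : IntegrableOn (fun y : Fin 2 → ℝ => (y 1) ^ ((a : ℝ) - 1) *
      (1 - y 0 + y 1) ^ ((b : ℝ) - 1)) E := by
    rw [← himage]
    refine (integrableOn_image_iff_integrableOn_abs_det_fderiv_smul volume hTm
      (fun x _ => (hderiv x).hasFDerivWithinAt) hinj _).2 ?_
    have hW : IntegrableOn W.integrand T := by simpa only [hWd] using W.integrableOn
    rw [hWi] at hW
    refine hW.congr_fun (fun x _ => ?_) hTm
    show (x 0 * x 1) ^ ((a : ℝ) - 1) * ((1 - x 0) * (1 - x 1)) ^ ((b : ℝ) - 1) * |x 0 - x 1| =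
      |(Φ' x).det| • ((Φ x 1) ^ ((a : ℝ) - 1) * (1 - Φ x 0 + Φ x 1) ^ ((b : ℝ) - 1))
    rw [hpt x, smul_eq_mul]
    ring
  let V : IntegralRep 2 :=
    ⟨E, fun y => (y 1) ^ ((a : ℝ) - 1) * (1 - y 0 + y 1) ^ ((b : ℝ) - 1), hE, hh, hint⟩
  refine ⟨V, rfl, rfl, ?_⟩
  have hsa : IsSemialgebraicMapOn ℚ T Φ := by
    convert isSemialgebraicMapOn_aeval hT ![(X 0 + X 1 : MvPolynomial (Fin 2) ℚ), X 0 * X 1]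
      using 2 with x
    exact funext (Fin.forall_fin_two.2 ⟨by simp [hΦ], by simp [hΦ]⟩)
  -- ONE change of variables from `W` onto `V`
  refine changeOfVariablesRel_subset_relations ⟨2, W, V, Φ, Φ', by rwa [hWd],
    fun x _ => (hderiv x).hasFDerivWithinAt, by rwa [hWd], ?_, fun x _ => ?_, rfl⟩
  · show E = Φ '' W.domain
    rw [hWd, himage]
  · rw [hWi]
    exact hpt x

/-- **The Jacobian identity of the AM–GM chart**: for `0 < w < 1`, `0 < t`,
`4w(1−w)t³ · ((wt)²)^{a−1} (1 − (1 + t²(2w−1)) + (wt)²)^{b−1} = 4w^{2a−1}(1−w)^{2b−1}t^{2a+2b−1}`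
(`1 − s + p = ((1−w)t)²`, real powers of squares, `(uv)^e = u^e v^e` for `u, v ≥ 0`). [folklore] -/
theorem jacobian_identity (a b : ℝ) {w t : ℝ} (hw : 0 < w) (hw1 : w < 1) (ht : 0 < t) :
    4 * w * (1 - w) * t ^ 3 * (((w * t) ^ 2) ^ (a - 1) *
        (1 - (1 + t ^ 2 * (2 * w - 1)) + (w * t) ^ 2) ^ (b - 1)) =
      4 * w ^ (2 * a - 1) * (1 - w) ^ (2 * b - 1) * t ^ (2 * a + 2 * b - 1) := by
  have h1w : 0 < 1 - w := sub_pos.2 hw1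
  rw [show 1 - (1 + t ^ 2 * (2 * w - 1)) + (w * t) ^ 2 = ((1 - w) * t) ^ 2 by ring]
  -- a real power of a square: `(u²)^e = u^{2e}` for `u ≥ 0`
  have h2 : ∀ u : ℝ, 0 ≤ u → ∀ e : ℝ, (u ^ 2) ^ e = u ^ (2 * e) := fun u hu e => by
    rw [← Real.rpow_natCast u 2, ← Real.rpow_mul hu]
    norm_num
  rw [h2 _ (mul_pos hw ht).le, h2 _ (mul_pos h1w ht).le, Real.mul_rpow hw.le ht.le,
    Real.mul_rpow h1w.le ht.le]
  have ew : w ^ (2 * a - 1) = w ^ (2 * (a - 1)) * w := by rw [← Real.rpow_add_one hw.ne']; ring_nf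
  have e1w : (1 - w) ^ (2 * b - 1) = (1 - w) ^ (2 * (b - 1)) * (1 - w) := by
    rw [← Real.rpow_add_one h1w.ne']; ring_nf
  have et : t ^ (2 * a + 2 * b - 1) = t ^ (2 * (a - 1)) * t ^ (2 * (b - 1)) * t ^ 3 := by
    rw [← Real.rpow_natCast t 3, ← Real.rpow_add ht, ← Real.rpow_add ht]
    push_cast
    ring_nf
  rw [ew, e1w, et]
  ring

/-- **The AM–GM pull-back.** For the Vieta representation `V = [E, p^{a−1}(1 − s + p)^{b−1}]`, the
honest pull-back `q` along the AM–GM chart `Ψ(w,t) = (1 + t²(2w−1), (wt)²)` of `E` by the open square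
exists (`tateLifting_pullback`), `[V] − [q] ∈ KZ.relations`, and the integrand of `q` is
`4w^{2a−1}(1−w)^{2b−1}t^{2a+2b−1}` on the square: `Ψ` is `ℚ`-polynomial, `det DΨ = 4w(1−w)t³ > 0`,
injective (positive square roots `wt = √p`, `(1−w)t = √(1−s+p)`) and ONTO `E`
(`s² − 4p = (1 − t²)(1 − t²(2w−1)²) > 0`; conversely `t = √p + √(1−s+p) < 1` because `4p < s²` —
the AM–GM / Cauchy–Schwarz defect). [cite: KontsevichZagier2001, §1.2 rule (2)] -/
theorem amgm_pullback (a b : ℚ) (V : IntegralRep 2)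
    (hVd : V.domain = {y | 0 < y 1 ∧ 0 < 1 - y 0 + y 1 ∧ 4 * y 1 < y 0 ^ 2 ∧ 0 < y 0 ∧ y 0 < 2})
    (hVi : V.integrand = fun y => (y 1) ^ ((a : ℝ) - 1) * (1 - y 0 + y 1) ^ ((b : ℝ) - 1)) :
    ∃ q : IntegralRep 2, q.domain = {z | ∀ i, z i ∈ Set.Ioo (0:ℝ) 1} ∧
      EqOn q.integrand (fun z => 4 * (z 0) ^ (2 * (a : ℝ) - 1) * (1 - z 0) ^ (2 * (b : ℝ) - 1) *
        (z 1) ^ (2 * (a : ℝ) + 2 * (b : ℝ) - 1)) q.domain ∧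
      of V - of q ∈ relations := by
  have hB := isSemialgebraic_box 2
  set B : Set (Fin 2 → ℝ) := {z | ∀ i, z i ∈ Set.Ioo (0:ℝ) 1}
  set Ψ : (Fin 2 → ℝ) → (Fin 2 → ℝ) :=
    fun z => ![1 + z 1 ^ 2 * (2 * z 0 - 1), (z 0 * z 1) ^ 2] with hΨ
  -- derivative and Jacobian `det DΨ = 4w(1−w)t³`
  have hD : ∀ z : Fin 2 → ℝ, ∃ L : (Fin 2 → ℝ) →L[ℝ] (Fin 2 → ℝ),
      HasFDerivAt Ψ L z ∧ L.det = 4 * z 0 * (1 - z 0) * z 1 ^ 3 := by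
    intro z
    have h0 : HasFDerivAt (fun y : Fin 2 → ℝ => y 0)
      (ContinuousLinearMap.proj (R := ℝ) (φ := fun _ : Fin 2 => ℝ) 0) z := hasFDerivAt_apply 0 z
    have h1 : HasFDerivAt (fun y : Fin 2 → ℝ => y 1)
      (ContinuousLinearMap.proj (R := ℝ) (φ := fun _ : Fin 2 => ℝ) 1) z := hasFDerivAt_apply 1 z
    refine ⟨_, (((h1.pow 2).mul ((h0.const_mul 2).sub_const 1)).const_add 1).finCons
      (((h0.mul h1).pow 2).finCons (hasFDerivAt_const ![] z)), ?_⟩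
    rw [ContinuousLinearMap.det, ← LinearMap.det_toMatrix', Matrix.det_fin_two]
    simp [LinearMap.toMatrix'_apply]
    ring
  choose Ψ' hderiv hdet using hD
  -- injective on the square: positive square roots are unique
  have hinj : InjOn Ψ B := by
    intro x hx y hy hxy
    have e0 : 1 + x 1 ^ 2 * (2 * x 0 - 1) = 1 + y 1 ^ 2 * (2 * y 0 - 1) := congrFun hxy 0
    have e1 : (x 0 * x 1) ^ 2 = (y 0 * y 1) ^ 2 := congrFun hxy 1
    have e2 : ((1 - x 0) * x 1) ^ 2 = ((1 - y 0) * y 1) ^ 2 := by linear_combination e1 - e0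
    rw [pow_left_inj₀ (mul_pos (hx 0).1 (hx 1).1).le (mul_pos (hy 0).1 (hy 1).1).le
      two_ne_zero] at e1
    rw [pow_left_inj₀ (mul_pos (sub_pos.2 (hx 0).2) (hx 1).1).le
      (mul_pos (sub_pos.2 (hy 0).2) (hy 1).1).le two_ne_zero] at e2
    have h1 : x 1 = y 1 := by linear_combination e1 + e2
    rw [h1] at e1
    exact funext (Fin.forall_fin_two.2 ⟨mul_right_cancel₀ (hy 1).1.ne' e1, h1⟩)
  have himage : Ψ '' B =
      {y | 0 < y 1 ∧ 0 < 1 - y 0 + y 1 ∧ 4 * y 1 < y 0 ^ 2 ∧ 0 < y 0 ∧ y 0 < 2} := by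
    ext y
    constructor
    · rintro ⟨z, hz, rfl⟩
      have hw0 : 0 < z 0 := (hz 0).1
      have hw1 : z 0 < 1 := (hz 0).2
      have ht0 : 0 < z 1 := (hz 1).1
      have ht2 : z 1 ^ 2 < 1 := by nlinarith [(hz 1).2]
      refine ⟨?_, ?_, ?_, ?_, ?_⟩
      · show 0 < (z 0 * z 1) ^ 2; positivity
      · show 0 < 1 - (1 + z 1 ^ 2 * (2 * z 0 - 1)) + (z 0 * z 1) ^ 2
        nlinarith [pow_pos (mul_pos (sub_pos.2 hw1) ht0) 2]
      · -- the discriminant `s² − 4p = (1 − t²)(1 − t²(2w−1)²) > 0`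
        show 4 * (z 0 * z 1) ^ 2 < (1 + z 1 ^ 2 * (2 * z 0 - 1)) ^ 2
        have hu2 : (2 * z 0 - 1) ^ 2 < 1 := by nlinarith
        have h2 : 0 < 1 - z 1 ^ 2 * (2 * z 0 - 1) ^ 2 := by
          nlinarith [mul_nonneg (sub_nonneg.2 ht2.le) (sq_nonneg (2 * z 0 - 1))]
        nlinarith [mul_pos (sub_pos.2 ht2) h2]
      · show 0 < 1 + z 1 ^ 2 * (2 * z 0 - 1); nlinarith [mul_nonneg (sq_nonneg (z 1)) hw0.le]
      · show 1 + z 1 ^ 2 * (2 * z 0 - 1) < 2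
        nlinarith [mul_nonneg (sq_nonneg (z 1)) (sub_pos.2 hw1).le]
    · rintro ⟨hy1, hy2, hy3, hy0, hy02⟩
      -- the two geometric means `A = √p`, `C = √(1 − s + p)` and their sum `t = A + C < 1`
      set A := Real.sqrt (y 1)
      set C := Real.sqrt (1 - y 0 + y 1)
      have hApos : 0 < A := Real.sqrt_pos.2 hy1
      have hA2 : A ^ 2 = y 1 := Real.sq_sqrt hy1.le
      have hC2 : C ^ 2 = 1 - y 0 + y 1 := Real.sq_sqrt hy2.le
      have ht : 0 < A + C := add_pos hApos (Real.sqrt_pos.2 hy2)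
      have h2AC : 2 * A * C < y 0 - 2 * y 1 := by
        have hpos : 0 < y 0 - 2 * y 1 := by nlinarith [mul_pos hy0 (sub_pos.2 hy02)]
        refine lt_of_pow_lt_pow_left₀ 2 hpos.le ?_
        rw [show (2 * A * C) ^ 2 = 4 * A ^ 2 * C ^ 2 by ring, hA2, hC2]
        nlinarith
      have ht1 : A + C < 1 := by
        refine (pow_lt_one_iff_of_nonneg ht.le two_ne_zero).1 ?_
        rw [show (A + C) ^ 2 = A ^ 2 + 2 * A * C + C ^ 2 by ring, hA2, hC2]
        linarith
      refine ⟨![A / (A + C), A + C], Fin.forall_fin_two.2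
        ⟨⟨div_pos hApos ht, (div_lt_one ht).2 (lt_add_of_pos_right A (Real.sqrt_pos.2 hy2))⟩, ⟨ht, ht1⟩⟩,
        funext (Fin.forall_fin_two.2 ⟨?_, ?_⟩)⟩
      · show 1 + (A + C) ^ 2 * (2 * (A / (A + C)) - 1) = y 0
        rw [show 1 + (A + C) ^ 2 * (2 * (A / (A + C)) - 1) = 1 + A ^ 2 - C ^ 2 by field_simp; ring,
          hA2, hC2]
        ring
      · show (A / (A + C) * (A + C)) ^ 2 = y 1
        rw [div_mul_cancel₀ A ht.ne', hA2]
  have hJ : IsSemialgebraicFunOn ℚ B (fun z => 4 * z 0 * (1 - z 0) * z 1 ^ 3) :=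
    (isSemialgebraicFunOn_aeval hB (4 * X 0 * (1 - X 0) * X 1 ^ 3 : MvPolynomial (Fin 2) ℚ)).congr
      fun z _ => by simp
  have hJdet : ∀ z ∈ B, 4 * z 0 * (1 - z 0) * z 1 ^ 3 = |(Ψ' z).det| := fun z hz => by
    rw [hdet z, abs_of_pos]
    exact mul_pos (mul_pos (mul_pos four_pos (hz 0).1) (sub_pos.2 (hz 0).2)) (pow_pos (hz 1).1 3)
  have hsa : IsSemialgebraicMapOn ℚ B Ψ := by
    convert isSemialgebraicMapOn_aeval hB
      ![(1 + X 1 ^ 2 * (2 * X 0 - 1) : MvPolynomial (Fin 2) ℚ), (X 0 * X 1) ^ 2] using 2 with z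
    exact funext (Fin.forall_fin_two.2 ⟨by simp [hΨ], by simp [hΨ]⟩)
  obtain ⟨q, hqd, hqi, hrel⟩ :=
    Summit.KontsevichZagierPeriods.InverseLandau.tateLifting_pullback 2 V B Ψ Ψ' _ hB hsa
      (fun z _ => (hderiv z).hasFDerivWithinAt) hinj (by rw [hVd, himage]) hJ hJdet
  refine ⟨q, hqd, fun z hz => ?_, hrel⟩
  rw [hqd] at hz; rw [hqi, hVi]
  exact jacobian_identity (a : ℝ) (b : ℝ) (hz 0).1 (hz 0).2 (hz 1).1

end DuplicationHalf

/-- **`SelbergDuplicationHalf`** (route SelbergAMGM, stmt-KontsevichZagierPeriods-5622): for rational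
`a, b` (`> 0`), any representation `r = [(0,1)², (x₀x₁)^{a−1}((1−x₀)(1−x₁))^{b−1}|x₀ − x₁|]` of the
`n = 2`, `γ = ½` Selberg integral is equivalent in the Kontsevich–Zagier calculus to any
representation `r' = [(0,1)², 8x₀^{2a−1}(1−x₀)^{2b−1}x₁^{2a+2b−1}]` of `8B(2a,2b)/(2a+2b)` — by
symmetrisation to the ordered half (rules (1), (1a), (2)), the Vieta chart `(x₀,x₁) ↦ (x₀+x₁, x₀x₁)`
whose Jacobian is the Vandermonde factor (rule (2)), the AM–GM chart `(w,t) ↦ (1 + t²(2w−1), (wt)²)`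
of the Vieta region by the square (rule (2)), and integrand additivity for the factor `2` (rule (1b)).
[cite: KontsevichZagier2001, §1.2 rules (1), (2)] -/
theorem selbergDuplicationHalf_proof :
    Summit.KontsevichZagierPeriods.KontsevichZagierPeriods.Theses.SelbergAMGM.SelbergDuplicationHalf := by
  intro a b _ _ r r' hrd hri hr'd hr'i
  -- symmetrisation `[r] − 2[W]` (the Selberg integrand is symmetric)
  obtain ⟨W, hWd, hWi, e0⟩ := DuplicationHalf.symmetrise _ (fun x => by
    simp only [Equiv.swap_apply_left, Equiv.swap_apply_right]
    rw [mul_comm (x 1) (x 0), mul_comm (1 - x 1) (1 - x 0), abs_sub_comm (x 1) (x 0)]) r hrd hri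
  -- the Vieta move `[W] − [V]` and the AM–GM pull-back `[V] − [q]`
  obtain ⟨V, hVd, hVi, e1⟩ := DuplicationHalf.vieta_move a b W hWd hWi
  obtain ⟨q, hqd, hqi, e2⟩ := DuplicationHalf.amgm_pullback a b V hVd hVi
  -- integrand additivity `[r'] − [q] − [q]` (the factor `2`)
  have e3 : of r' - of q - of q ∈ relations := by
    refine integrandAddRel_subset_relations
      ⟨2, r', q, q, by rw [hqd, hr'd], by rw [hqd, hr'd], fun z hz => ?_, rfl⟩
    have hz' : z ∈ q.domain := by rwa [hqd, ← hr'd]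
    rw [hr'i hz, Pi.add_apply, hqi hz']
    ring
  -- bookkeeping: `[r] − [r'] = ([r] − 2[W]) + 2([W] − [V]) + 2([V] − [q]) − ([r'] − [q] − [q])`
  show of r - of r' ∈ relations
  rw [show of r - of r' = (of r - 2 • of W) + 2 • (of W - of V) + 2 • (of V - of q) -
      (of r' - of q - of q) by abel]
  exact relations.sub_mem (relations.add_mem (relations.add_mem e0 (relations.nsmul_mem e1 2))
    (relations.nsmul_mem e2 2)) e3

end Summit.KontsevichZagierPeriods.SelbergAMGM

end
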